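import Summits.ValiantsHypothesis.ValiantsHypothesis.Theses.RigidityForcesSymmetry

/-!
# Route RigidityForcesSymmetry — item `Assembly`

Settles item `stmt-ValiantsHypothesis-4168` (rank-1 assembly of route `RigidityForcesSymmetry`):
`RigidMinimalRepr → RigidityForcesTorus → TorusBound → GrenetBoundToVH → ValiantsHypothesis`.

Pure bookkeeping. Given `n₀`, `RigidMinimalRepr` applied at `max n₀ 3` yields `n ≥ max n₀ 3` (so `n ≥ n₀`
and `n ≥ 3`) together with a minimal-size affine determinantal representation `(Λ, A)` of `per_n`
(`m = dc(per_n)`) whose `GL_m × GL_m`-orbit is locally open; `RigidityForcesTorus` (stated with literally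
the same sub-expressions) makes `Λ.map C + ∑ v, X v • (A v).map C` two-sided-torus-equivariant with exact
lifts; `TorusBound` then gives `2 ^ n - 1 ≤ m = dc(per_n)`, which is `GrenetLowerBound` at `n₀`; finally
`GrenetBoundToVH : GrenetLowerBound → ValiantsHypothesis` concludes. No library lemma beyond `le_max_left`,
`le_max_right` is used; the theorem is unconditional (its hypotheses are exactly the route's items).
-/

namespace Summit.ValiantsHypothesis.Theorems.RigidityForcesSymmetry

open Summit.ValiantsHypothesis.ValiantsHypothesis.Theses.RigidityForcesSymmetry

/-- Settles `stmt-ValiantsHypothesis-4168` (assembly of route `RigidityForcesSymmetry`):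
`RigidMinimalRepr → RigidityForcesTorus → TorusBound → GrenetBoundToVH → ValiantsHypothesis`.
Proof: to get `GrenetLowerBound` at `n₀`, take the minimal locally rigid representation of `per_n`,
`n ≥ max n₀ 3`, given by `RigidMinimalRepr`; it is two-sided-torus-equivariant by `RigidityForcesTorus`
(`n ≥ 3`), hence has size `m ≥ 2 ^ n - 1` by `TorusBound`, and `m = dc(per_n)`; then apply
`GrenetBoundToVH`. [folklore] -/
theorem Assembly_proof :
    Summit.ValiantsHypothesis.ValiantsHypothesis.Theses.RigidityForcesSymmetry.Assembly := by
  unfold Summit.ValiantsHypothesis.ValiantsHypothesis.Theses.RigidityForcesSymmetry.Assembly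
  intro hRigid hTorus hBound hVH
  refine hVH ?_
  intro n₀
  obtain ⟨n, hn, m, Λ, A, hm, hdet, hU⟩ := hRigid (max n₀ 3)
  have h₃ : 3 ≤ n := le_trans (le_max_right n₀ 3) hn
  refine ⟨n, le_trans (le_max_left n₀ 3) hn, ?_⟩
  have hb : 2 ^ n - 1 ≤ m := hBound n h₃ m _ (hTorus n h₃ m Λ A hdet hU)
  rw [hm] at hb
  exact hb

end Summit.ValiantsHypothesis.Theorems.RigidityForcesSymmetry
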